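import Summits.AtomisticToContinuum.Crystallization.Theorems.PalmUnimodularRigidityLayeredLawsSelectHcpZeroStressSymmetry

/-!
# Zero site stress of relaxed hcp, II: the diagonal by Fermat, and the stub
(stub `stub_zeroStress` of line `mtp-prestress-split-ergodic-frame`, crux `LayeredLawsSelectHcp`,
stmt-AtomisticToContinuum-9226)

Part I (`…ZeroStressSymmetry`) killed the off-diagonal entries of the site stress tensor
`S_lm(a,h) = ∑_{v ≠ 0} W′(‖y_v‖²) (y_v)_l (y_v)_m` of `hcp(a,h)` and gave `S₀₀ = S₁₁`, for all
`a, h ≠ 0`. Here, at a GLOBAL MINIMISER `(a₀, h₀)` of the total energy function `hcpE` on the open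
quadrant, the diagonal vanishes. Write `h = a c` and `q_v = Q v + k² c²`, so that `‖y_v‖² = a² q_v`
and `hcpE a (a c) = ½ (a⁻¹² S₆(c)/12 − a⁻⁶ S₃(c)/6)` with the pure lattice sums
`S_n(c) = ∑' [v≠0] q_v⁻ⁿ` (the landed `hcpPinC_energy_formula`); let `D_n(c) = ∑' [v≠0] k² q_v⁻ⁿ⁻¹`.

* minimality in the dilation `a` gives `a₀⁶ = S₆/S₃`, and in the layer ratio `c` (termwise
  differentiation, the landed `hcpPinC_hasDerivAt_tsum`) `S₆ D₃ = S₃ D₆` (`hcpE_min_relations`,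
  the argument of the landed `stub_pinFromSeries` over the total function `hcpE`);
* the trace is `S₀₀ + S₁₁ + S₂₂ = ∑' [v≠0] W′(s_v) s_v = ½ (a⁻⁶ S₃ − a⁻¹² S₆) = 0`
  (`hcpSiteStress_trace`), and `S₂₂ = ∑' [v≠0] W′(s_v) k² h² = ½ c² (a⁻⁶ D₃ − a⁻¹² D₆) = 0`
  (`hcpSiteStress_two_two`); with `S₀₀ = S₁₁` every entry vanishes (`stub_zeroStress`).

All `[folklore]`.
-/

noncomputable section

namespace Summit.AtomisticToContinuum.Crystallization.Theorems.PalmUnimodularRigidity.LayeredLawsSelectHcp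

open MeasureTheory Set
open Literature.MathematicalPhysics.StatisticalMechanics Literature.Geometry.DiscreteGeometry
open Summit.AtomisticToContinuum.Crystallization.Theorems.ExcessDecayLiouvilleCoarseGrains
  (hcpEnergySeries_of_eq hcpPinC_Q_nonneg hcpPinC_Q_pos hcpPinC_p_pos hcpPinC_tsum_pos
   hcpPinC_energy_formula hcpPinC_dilation_value hcpPinC_dilation_eq hcpPinC_fermat_alg
   hcpPinC_hasDerivAt_tsum hcpPinC_deriv_bound)

/-! ## Pure lattice sums at `(a, a c)` and the two minimality relations -/

/-- `Q > 0` off the root in the layer `k = 0`. [folklore] -/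
theorem hcpQ_pos_of_layer_zero (v : ℤ × ℤ × ℤ) (hv : v ≠ 0) (hk : v.1 = 0) : 0 < hcpQ v :=
  hcpPinC_Q_pos v hv hk

/-- **Series split at `(a, a c)`.** The pure lattice sums `S₃(c) = ∑' [v≠0] (Q v + k² c²)⁻³`,
`S₆(c)` converge and `hcpE a (a c) = ½ (a⁻¹² S₆(c)/12 − a⁻⁶ S₃(c)/6)` (`a, c ≠ 0`; from the landed
`hcpEnergySeries_of_eq` and `hcpPinC_energy_formula`). [folklore] -/
theorem hcpE_latticeSums {a c : ℝ} (ha : a ≠ 0) (hc : c ≠ 0) :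
    (Summable fun v : ℤ × ℤ × ℤ =>
        if v = 0 then (0 : ℝ) else ((hcpQ v + (v.1 : ℝ) ^ 2 * c ^ 2)⁻¹) ^ 3) ∧
    (Summable fun v : ℤ × ℤ × ℤ =>
        if v = 0 then (0 : ℝ) else ((hcpQ v + (v.1 : ℝ) ^ 2 * c ^ 2)⁻¹) ^ 6) ∧
    hcpE a (a * c) = 1 / 2 * ((1 / 12) * (a ^ 12)⁻¹ * (∑' v : ℤ × ℤ × ℤ,
        if v = 0 then (0 : ℝ) else ((hcpQ v + (v.1 : ℝ) ^ 2 * c ^ 2)⁻¹) ^ 6) -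
      (1 / 6) * (a ^ 6)⁻¹ * (∑' v : ℤ × ℤ × ℤ,
        if v = 0 then (0 : ℝ) else ((hcpQ v + (v.1 : ℝ) ^ 2 * c ^ 2)⁻¹) ^ 3)) := by
  have hh : a * c ≠ 0 := mul_ne_zero ha hc
  obtain ⟨h1, h2, -⟩ := hcpEnergySeries_of_eq a (a * c) ha hh hcpQ rfl
  have key := hcpPinC_energy_formula hcpQ hcpQ_nonneg ha h1 h2 (rfl : hcpE a (a * c) = _)
  rw [mul_div_cancel_left₀ c ha] at key
  exact key

/-- The pure lattice sums are positive. [folklore] -/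
theorem hcpLatticeSum_pos {c : ℝ} (hc : c ≠ 0) (n : ℕ)
    (hS : Summable fun v : ℤ × ℤ × ℤ =>
      if v = 0 then (0 : ℝ) else ((hcpQ v + (v.1 : ℝ) ^ 2 * c ^ 2)⁻¹) ^ n) :
    0 < ∑' v : ℤ × ℤ × ℤ, if v = 0 then (0 : ℝ) else ((hcpQ v + (v.1 : ℝ) ^ 2 * c ^ 2)⁻¹) ^ n :=
  hcpPinC_tsum_pos hcpQ_nonneg hcpQ_pos_of_layer_zero hc n hS

/-- The layer-weighted sums `D_n(c) = ∑' [v≠0] k² (Q v + k² c²)⁻ⁿ⁻¹` converge (`n ≠ 0`, `c > 0`;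
the bound `hcpPinC_deriv_bound` against `S_n(c/2)`). [folklore] -/
theorem summable_hcpLatticeD {c : ℝ} (hc : 0 < c) {n : ℕ} (hn : n ≠ 0)
    (hhalf : Summable fun v : ℤ × ℤ × ℤ =>
      if v = 0 then (0 : ℝ) else ((hcpQ v + (v.1 : ℝ) ^ 2 * (c / 2) ^ 2)⁻¹) ^ n) :
    Summable fun v : ℤ × ℤ × ℤ => if v = 0 then (0 : ℝ) else
      (v.1 : ℝ) ^ 2 * ((hcpQ v + (v.1 : ℝ) ^ 2 * c ^ 2)⁻¹) ^ (n + 1) := by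
  have hmem : c ∈ Set.Ioo (c / 2) (2 * c) := ⟨by linarith, by linarith⟩
  have h1 : Summable fun v : ℤ × ℤ × ℤ => -(2 * n * c) * (if v = 0 then (0 : ℝ) else
      (v.1 : ℝ) ^ 2 * ((hcpQ v + (v.1 : ℝ) ^ 2 * c ^ 2)⁻¹) ^ (n + 1)) :=
    Summable.of_norm_bounded (hhalf.mul_left (16 * n / c))
      fun v => hcpPinC_deriv_bound hcpQ_nonneg hcpQ_pos_of_layer_zero n hc hmem v
  have hn' : (n : ℝ) ≠ 0 := Nat.cast_ne_zero.2 hn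
  have hconst : -(2 * (n : ℝ) * c) ≠ 0 := by
    refine neg_ne_zero.2 (mul_ne_zero (mul_ne_zero two_ne_zero hn') hc.ne')
  exact (summable_mul_left_iff hconst).1 h1

/-- **The two minimality relations.** If `hcpE a (a c) ≤ hcpE a' h'` for all `a', h' > 0`
(`a, c > 0`), then DILATION OPTIMALITY `a⁶ = S₆(c)/S₃(c)` and FERMAT IN THE LAYER SPACING
`S₆(c) D₃(c) = S₃(c) D₆(c)` (the argument of the landed `stub_pinFromSeries`, verbatim over the total
function `hcpE`). [folklore] -/
theorem hcpE_min_relations {a c : ℝ} (ha : 0 < a) (hc : 0 < c)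
    (hmin : ∀ a' h' : ℝ, 0 < a' → 0 < h' → hcpE a (a * c) ≤ hcpE a' h') :
    a ^ 6 = (∑' v : ℤ × ℤ × ℤ,
        if v = 0 then (0 : ℝ) else ((hcpQ v + (v.1 : ℝ) ^ 2 * c ^ 2)⁻¹) ^ 6) /
      (∑' v : ℤ × ℤ × ℤ,
        if v = 0 then (0 : ℝ) else ((hcpQ v + (v.1 : ℝ) ^ 2 * c ^ 2)⁻¹) ^ 3) ∧
    (∑' v : ℤ × ℤ × ℤ,
        if v = 0 then (0 : ℝ) else ((hcpQ v + (v.1 : ℝ) ^ 2 * c ^ 2)⁻¹) ^ 6) *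
      (∑' v : ℤ × ℤ × ℤ, if v = 0 then (0 : ℝ) else
        (v.1 : ℝ) ^ 2 * ((hcpQ v + (v.1 : ℝ) ^ 2 * c ^ 2)⁻¹) ^ (3 + 1)) =
    (∑' v : ℤ × ℤ × ℤ,
        if v = 0 then (0 : ℝ) else ((hcpQ v + (v.1 : ℝ) ^ 2 * c ^ 2)⁻¹) ^ 3) *
      (∑' v : ℤ × ℤ × ℤ, if v = 0 then (0 : ℝ) else
        (v.1 : ℝ) ^ 2 * ((hcpQ v + (v.1 : ℝ) ^ 2 * c ^ 2)⁻¹) ^ (6 + 1)) := by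
  -- the lattice sums as functions of the layer ratio
  set S : ℕ → ℝ → ℝ := fun n y => ∑' v : ℤ × ℤ × ℤ,
    if v = 0 then (0 : ℝ) else ((hcpQ v + (v.1 : ℝ) ^ 2 * y ^ 2)⁻¹) ^ n with hS
  set D : ℕ → ℝ → ℝ := fun n y => ∑' v : ℤ × ℤ × ℤ, if v = 0 then (0 : ℝ) else
    (v.1 : ℝ) ^ 2 * ((hcpQ v + (v.1 : ℝ) ^ 2 * y ^ 2)⁻¹) ^ (n + 1) with hD
  change a ^ 6 = S 6 c / S 3 c ∧ S 6 c * D 3 c = S 3 c * D 6 c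
  have hT : ∀ c' : ℝ, c' ≠ 0 →
      (Summable fun v : ℤ × ℤ × ℤ =>
        if v = 0 then (0 : ℝ) else ((hcpQ v + (v.1 : ℝ) ^ 2 * c' ^ 2)⁻¹) ^ 3) ∧
      (Summable fun v : ℤ × ℤ × ℤ =>
        if v = 0 then (0 : ℝ) else ((hcpQ v + (v.1 : ℝ) ^ 2 * c' ^ 2)⁻¹) ^ 6) := fun c' hc' =>
    ⟨(hcpE_latticeSums one_ne_zero hc').1, (hcpE_latticeSums one_ne_zero hc').2.1⟩
  have hSpos : ∀ (n : ℕ) (c' : ℝ), c' ≠ 0 →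
      (Summable fun v : ℤ × ℤ × ℤ =>
        if v = 0 then (0 : ℝ) else ((hcpQ v + (v.1 : ℝ) ^ 2 * c' ^ 2)⁻¹) ^ n) → 0 < S n c' :=
    fun n c' hc' hs => hcpLatticeSum_pos hc' n hs
  have hE : ∀ (a' c' : ℝ), a' ≠ 0 → c' ≠ 0 →
      hcpE a' (a' * c') = 1 / 2 * ((1 / 12) * (a' ^ 12)⁻¹ * S 6 c' - (1 / 6) * (a' ^ 6)⁻¹ * S 3 c') :=
    fun a' c' ha' hc' => (hcpE_latticeSums ha' hc').2.2
  -- comparison with the optimally dilated hcp of shape `c'`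
  have hI : ∀ c' : ℝ, 0 < c' → hcpE a (a * c) ≤ -(S 3 c' ^ 2 / (24 * S 6 c')) := by
    intro c' hc'
    have h3 := hSpos 3 c' hc'.ne' (hT c' hc'.ne').1
    have h6 := hSpos 6 c' hc'.ne' (hT c' hc'.ne').2
    have hq : 0 < S 6 c' / S 3 c' := div_pos h6 h3
    obtain ⟨b, hb0, hb6⟩ : ∃ b : ℝ, 0 < b ∧ b ^ 6 = S 6 c' / S 3 c' :=
      ⟨(S 6 c' / S 3 c') ^ ((6 : ℕ) : ℝ)⁻¹, Real.rpow_pos_of_pos hq _,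
        Real.rpow_inv_natCast_pow hq.le (by norm_num)⟩
    have key := hmin b (b * c') hb0 (mul_pos hb0 hc')
    rw [hE b c' hb0.ne' hc'.ne', hcpPinC_dilation_value h3 h6 hb6] at key
    exact key
  have hS3 := hSpos 3 c hc.ne' (hT c hc.ne').1
  have hS6 := hSpos 6 c hc.ne' (hT c hc.ne').2
  have he := hE a c ha.ne' hc.ne'
  have ha6 : a ^ 6 = S 6 c / S 3 c :=
    hcpPinC_dilation_eq hS3 hS6 ha.ne' (by rw [← he]; exact hI c hc)
  -- Fermat in the layer spacing
  have hderiv : ∀ n : ℕ, (∀ c' : ℝ, c' ≠ 0 → Summable fun v : ℤ × ℤ × ℤ =>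
        if v = 0 then (0 : ℝ) else ((hcpQ v + (v.1 : ℝ) ^ 2 * c' ^ 2)⁻¹) ^ n) →
      HasDerivAt (S n) (-(2 * n * c) * D n c) c := fun n hsum =>
    hcpPinC_hasDerivAt_tsum hcpQ_nonneg hcpQ_pos_of_layer_zero n hc
      (hsum _ (half_pos hc).ne') (hsum _ hc.ne')
  have hd3 := hderiv 3 fun c' hc' => (hT c' hc').1
  have hd6 := hderiv 6 fun c' hc' => (hT c' hc').2
  have hφ := (hd6.const_mul (1 / 12 * (a ^ 12)⁻¹)).sub (hd3.const_mul (1 / 6 * (a ^ 6)⁻¹))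
  have hloc : IsLocalMin (fun y => 1 / 12 * (a ^ 12)⁻¹ * S 6 y - 1 / 6 * (a ^ 6)⁻¹ * S 3 y)
      c := by
    filter_upwards [Ioi_mem_nhds hc] with y hy
    have hy0 : (0 : ℝ) < y := hy
    have key := hmin a (a * y) ha (mul_pos ha hy0)
    rw [he, hE a y ha.ne' hy0.ne'] at key
    linarith
  have hzero := hloc.hasDerivAt_eq_zero hφ
  push_cast at hzero
  have hferm : S 6 c * D 3 c = S 3 c * D 6 c :=
    hcpPinC_fermat_alg hS3 ha.ne' hc.ne' ha6 (by linarith)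
  exact ⟨ha6, hferm⟩

/-! ## The trace and the `zz` entry as lattice sums -/

/-- `‖y_v‖² = a² (Q v + k² c²)` at `h = a c`. [folklore] -/
theorem hcpSite_norm_sq_ratio (a c : ℝ) (v : ℤ × ℤ × ℤ) :
    ‖hcpSite a (a * c) v‖ ^ 2 = a ^ 2 * (hcpQ v + (v.1 : ℝ) ^ 2 * c ^ 2) := by
  rw [hcpSite_norm_sq]; ring

/-- **The trace is the dilation derivative**:
`S₀₀ + S₁₁ + S₂₂ = ∑' [v≠0] W′(s_v) s_v = ½ (a⁻⁶ S₃(c) − a⁻¹² S₆(c))` at `h = a c`. [folklore] -/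
theorem hcpSiteStress_trace {a c : ℝ} (ha : a ≠ 0) (hc : c ≠ 0) :
    hcpSiteStress a (a * c) 0 0 + hcpSiteStress a (a * c) 1 1 + hcpSiteStress a (a * c) 2 2 =
      1 / 2 * ((a ^ 6)⁻¹ * (∑' v : ℤ × ℤ × ℤ,
          if v = 0 then (0 : ℝ) else ((hcpQ v + (v.1 : ℝ) ^ 2 * c ^ 2)⁻¹) ^ 3) -
        (a ^ 12)⁻¹ * (∑' v : ℤ × ℤ × ℤ,
          if v = 0 then (0 : ℝ) else ((hcpQ v + (v.1 : ℝ) ^ 2 * c ^ 2)⁻¹) ^ 6)) := by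
  have hh : a * c ≠ 0 := mul_ne_zero ha hc
  obtain ⟨hT3, hT6, -⟩ := hcpE_latticeSums ha hc
  have hs := fun l m => summable_hcpStressTerm ha hh l m
  unfold hcpSiteStress
  rw [← (hs 0 0).tsum_add (hs 1 1), ← ((hs 0 0).add (hs 1 1)).tsum_add (hs 2 2),
    ← tsum_mul_left, ← tsum_mul_left, ← (hT3.mul_left _).tsum_sub (hT6.mul_left _),
    ← tsum_mul_left]
  refine tsum_congr fun v => ?_
  by_cases hv : v = 0
  · simp [hv]
  · simp only [if_neg hv]
    have hq : 0 < hcpQ v + (v.1 : ℝ) ^ 2 * c ^ 2 :=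
      hcpPinC_p_pos hcpQ_nonneg hcpQ_pos_of_layer_zero hv hc
    have hn : ‖hcpSite a (a * c) v‖ ^ 2 =
        hcpSite a (a * c) v 0 ^ 2 + hcpSite a (a * c) v 1 ^ 2 + hcpSite a (a * c) v 2 ^ 2 := by
      rw [EuclideanSpace.norm_sq_eq, Fin.sum_univ_three]
      simp [sq_abs]
    rw [hcpSite_norm_sq_ratio] at hn ⊢
    have hq' := hq.ne'
    generalize hcpQ v + (v.1 : ℝ) ^ 2 * c ^ 2 = q at hn hq' ⊢
    calc ljSqDeriv (a ^ 2 * q) * (hcpSite a (a * c) v 0 * hcpSite a (a * c) v 0) +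
        ljSqDeriv (a ^ 2 * q) * (hcpSite a (a * c) v 1 * hcpSite a (a * c) v 1) +
        ljSqDeriv (a ^ 2 * q) * (hcpSite a (a * c) v 2 * hcpSite a (a * c) v 2)
        = ljSqDeriv (a ^ 2 * q) * (a ^ 2 * q) := by rw [hn]; ring
      _ = _ := by
          unfold ljSqDeriv
          field_simp

/-- **The `zz` entry is the layer-spacing derivative**:
`S₂₂ = ∑' [v≠0] W′(s_v) k² h² = ½ c² (a⁻⁶ D₃(c) − a⁻¹² D₆(c))` at `h = a c`. [folklore] -/
theorem hcpSiteStress_two_two {a c : ℝ} (ha : a ≠ 0) (hc : 0 < c) :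
    hcpSiteStress a (a * c) 2 2 =
      1 / 2 * c ^ 2 * ((a ^ 6)⁻¹ * (∑' v : ℤ × ℤ × ℤ, if v = 0 then (0 : ℝ) else
          (v.1 : ℝ) ^ 2 * ((hcpQ v + (v.1 : ℝ) ^ 2 * c ^ 2)⁻¹) ^ (3 + 1)) -
        (a ^ 12)⁻¹ * (∑' v : ℤ × ℤ × ℤ, if v = 0 then (0 : ℝ) else
          (v.1 : ℝ) ^ 2 * ((hcpQ v + (v.1 : ℝ) ^ 2 * c ^ 2)⁻¹) ^ (6 + 1))) := by
  have hc2 : c / 2 ≠ 0 := (half_pos hc).ne'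
  obtain ⟨hT3, hT6, -⟩ := hcpE_latticeSums (one_ne_zero) hc2
  have hD3 := summable_hcpLatticeD hc (by norm_num : (3 : ℕ) ≠ 0) hT3
  have hD6 := summable_hcpLatticeD hc (by norm_num : (6 : ℕ) ≠ 0) hT6
  unfold hcpSiteStress
  rw [← tsum_mul_left, ← tsum_mul_left, ← (hD3.mul_left _).tsum_sub (hD6.mul_left _),
    ← tsum_mul_left]
  refine tsum_congr fun v => ?_
  by_cases hv : v = 0
  · simp [hv]
  · simp only [if_neg hv]
    have hq : 0 < hcpQ v + (v.1 : ℝ) ^ 2 * c ^ 2 :=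
      hcpPinC_p_pos hcpQ_nonneg hcpQ_pos_of_layer_zero hv hc.ne'
    rw [hcpSite_norm_sq_ratio, hcpSite_apply_two]
    have hq' := hq.ne'
    generalize hcpQ v + (v.1 : ℝ) ^ 2 * c ^ 2 = q at hq' ⊢
    unfold ljSqDeriv
    simp only [Nat.reduceAdd]
    field_simp

/-! ## The statement -/

/-- **Stub `stub_zeroStress` of line `mtp-prestress-split-ergodic-frame` (crux
`LayeredLawsSelectHcp`, stmt-AtomisticToContinuum-9226): ZERO SITE STRESS OF THE RELAXED
REFERENCE.** At a global minimiser `(a₀, h₀)` of the total hcp energy function `hcpE` on the open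
quadrant, the squared-length site stress tensor `S_lm = ∑_{v≠0} W′(‖y_v‖²)(y_v)_l(y_v)_m`
vanishes: the mirrors `x ↦ −x`, `z ↦ −z` kill the off-diagonal entries and the `π/6` mirror gives
`S₀₀ = S₁₁` (`stub_zeroStressSymmetry`); dilation optimality `a₀⁶ = S₆/S₃` kills the trace and
Fermat in the layer spacing `S₆ D₃ = S₃ D₆` kills `S₂₂` (`c = h₀/a₀`). [folklore] -/
theorem stub_zeroStress : ∀ a₀ h₀ : ℝ, 0 < a₀ → 0 < h₀ →
    (∀ a h : ℝ, 0 < a → 0 < h → hcpE a₀ h₀ ≤ hcpE a h) →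
      ∀ l m : Fin 3, hcpSiteStress a₀ h₀ l m = 0 := by
  intro a₀ h₀ ha hh hmin
  obtain ⟨c, rfl⟩ : ∃ c, h₀ = a₀ * c := ⟨h₀ / a₀, by field_simp⟩
  have hc : 0 < c := pos_of_mul_pos_right hh ha.le
  -- abbreviations for the four lattice sums at `c`
  obtain ⟨hT3, hT6, -⟩ := hcpE_latticeSums ha.ne' hc.ne'
  have hS3 := hcpLatticeSum_pos hc.ne' 3 hT3
  have hS6 := hcpLatticeSum_pos hc.ne' 6 hT6
  obtain ⟨ha6, hferm⟩ := hcpE_min_relations ha hc hmin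
  obtain ⟨h01, h02, h12, h0011, hsymm⟩ := stub_zeroStressSymmetry a₀ (a₀ * c) ha.ne' hh.ne'
  have htr := hcpSiteStress_trace ha.ne' hc.ne'
  have h22f := hcpSiteStress_two_two ha.ne' hc
  set S3 := ∑' v : ℤ × ℤ × ℤ,
    if v = 0 then (0 : ℝ) else ((hcpQ v + (v.1 : ℝ) ^ 2 * c ^ 2)⁻¹) ^ 3 with hS3def
  set S6 := ∑' v : ℤ × ℤ × ℤ,
    if v = 0 then (0 : ℝ) else ((hcpQ v + (v.1 : ℝ) ^ 2 * c ^ 2)⁻¹) ^ 6 with hS6def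
  set D3 := ∑' v : ℤ × ℤ × ℤ, if v = 0 then (0 : ℝ) else
    (v.1 : ℝ) ^ 2 * ((hcpQ v + (v.1 : ℝ) ^ 2 * c ^ 2)⁻¹) ^ (3 + 1) with hD3def
  set D6 := ∑' v : ℤ × ℤ × ℤ, if v = 0 then (0 : ℝ) else
    (v.1 : ℝ) ^ 2 * ((hcpQ v + (v.1 : ℝ) ^ 2 * c ^ 2)⁻¹) ^ (6 + 1) with hD6def
  have ha12 : a₀ ^ 12 = (a₀ ^ 6) ^ 2 := by ring
  have h22 : hcpSiteStress a₀ (a₀ * c) 2 2 = 0 := by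
    rw [h22f, ha12, ha6]
    have hD6 : D6 = S6 * D3 / S3 := by
      field_simp
      linarith [hferm]
    rw [hD6]
    field_simp
    ring
  have htr0 : hcpSiteStress a₀ (a₀ * c) 0 0 + hcpSiteStress a₀ (a₀ * c) 1 1 +
      hcpSiteStress a₀ (a₀ * c) 2 2 = 0 := by
    rw [htr, ha12, ha6]
    field_simp
    ring
  have h00 : hcpSiteStress a₀ (a₀ * c) 0 0 = 0 := by linarith
  have h11 : hcpSiteStress a₀ (a₀ * c) 1 1 = 0 := by linarith
  intro l m
  fin_cases l <;> fin_cases m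
  · exact h00
  · exact h01
  · exact h02
  · exact (hsymm 1 0).trans h01
  · exact h11
  · exact h12
  · exact (hsymm 2 0).trans h02
  · exact (hsymm 2 1).trans h12
  · exact h22

end Summit.AtomisticToContinuum.Crystallization.Theorems.PalmUnimodularRigidity.LayeredLawsSelectHcp

end
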